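import Mathlib
import Summits.Ventures.PercRepro2.TwoHullMaster

/-!
# The rigid two-hull master statement is the two-sided permutation on every `l`-class (blind cell
PercRepro2, night-4 g39, 2026-08-29; proofs/NIGHT4-G39.md §6)

By Hall's marriage theorem the rigid (MM) of TwoHullMaster.lean is EQUIVALENT to the lane's
TWO-SIDED rigid permutation (the rigid SwPair / (JDr) of NIGHT4-G6 §4.3) on every class
`{h ∉ H_l, (C_R(l), C_B(l)) ∈ 𝓦l}`, `𝓦l` an up-set of pairs: a permutation `Φ` of the class under
which every red edge of `C_R(h)` of the source is a blue edge of `C_B(h)` of the image AND every red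
edge of `C_R(h)` of the image is a blue edge of `C_B(h)` of the source (`TwoSided`).  The side of `o`
is the class `𝓦l = {o ∈ A, o ∉ B}`, so (JDr) itself is the case of one class.

* `TwoSided`, `lClass`, `mem_lClass`;
* `twoHullMasterRigid_of_twoSided` — the permutations give the counting inequalities;
* `exists_twoSided_of_twoHullMasterRigid` — Hall: the counting inequalities give the permutations;
* **`twoHullMasterRigid_iff_twoSided`**.
-/

namespace Summit.Ventures.PercRepro2

namespace LocRows

open Hull

variable {V : Type*} {E : Type*} [Fintype E] [DecidableEq E]

open scoped Classical

variable (ends : E → Sym2 V)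

/-- The two-sided rigid relation at `h`: every red edge of `C_R(h)` of each configuration is a blue
edge of `C_B(h)` of the other. -/
def TwoSided (ζ η : Config E) (h : V) : Prop :=
  redEdges ends ζ h ⊆ blueEdges ends η h ∧ redEdges ends η h ⊆ blueEdges ends ζ h

/-- The `l`-class of an up-set of pairs: `h ∉ H_l` and the hull pair of `l` in `𝓦l`. -/
noncomputable def lClass (l h : V) (𝓦l : Set (Set V × Set V)) : Finset (Config E) :=
  Finset.univ.filter fun ζ => h ∉ hull ends ζ l ∧ hullPair ends ζ l ∈ 𝓦l

variable {ends}

/-- Membership in the `l`-class. -/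
lemma mem_lClass {l h : V} {𝓦l : Set (Set V × Set V)} {ζ : Config E} :
    ζ ∈ lClass ends l h 𝓦l ↔ h ∉ hull ends ζ l ∧ hullPair ends ζ l ∈ 𝓦l := by
  simp only [lClass, Finset.mem_filter, Finset.mem_univ, true_and]

/-- The rigid two-hull class is the `l`-class filtered by the rigid pair of `h`. -/
lemma twoHullClassE_eq_filter (l h : V) (𝓦l : Set (Set V × Set V)) (𝓦h : Set (Set E × Set E)) :
    twoHullClassE ends l h 𝓦l 𝓦h = (lClass ends l h 𝓦l).filter fun ζ => edgePair ends ζ h ∈ 𝓦h := by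
  ext ζ
  rw [mem_twoHullClassE, Finset.mem_filter, mem_lClass]
  tauto

/-- **The two-sided permutations give the rigid (MM)**: an injection of each `l`-class into itself
under the two-sided relation carries the class of `𝓦h` into the class of its mirror. -/
theorem twoHullMasterRigid_of_twoSided {l h : V}
    (hf : ∀ 𝓦l : Set (Set V × Set V), IsPairUpSet 𝓦l →
      ∃ f : {ζ // ζ ∈ lClass ends l h 𝓦l} → Config E, Function.Injective f ∧
        ∀ x, f x ∈ lClass ends l h 𝓦l ∧ TwoSided ends x.1 (f x) h) :
    TwoHullMasterRigid ends l h := by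
  intro 𝓦l 𝓦h h𝓦l h𝓦h
  obtain ⟨f, hinj, hmem⟩ := hf 𝓦l h𝓦l
  rw [twoHullClassE_eq_filter, twoHullClassE_eq_filter]
  let F : Config E → Config E := fun ζ =>
    if hζ : ζ ∈ lClass ends l h 𝓦l then f ⟨ζ, hζ⟩ else ζ
  refine Finset.card_le_card_of_injOn F ?_ ?_
  · intro ζ hζ
    rw [Finset.mem_coe, Finset.mem_filter] at hζ
    have hF : F ζ = f ⟨ζ, hζ.1⟩ := by simp [F, hζ.1]
    rw [Finset.mem_coe, Finset.mem_filter, hF]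
    obtain ⟨hcl, hred, hblue⟩ := hmem ⟨ζ, hζ.1⟩
    refine ⟨hcl, ?_⟩
    rw [mem_mirror]
    exact h𝓦h _ _ _ _ hred hblue hζ.2
  · intro ζ₁ hζ₁ ζ₂ hζ₂ hF
    rw [Finset.mem_coe, Finset.mem_filter] at hζ₁ hζ₂
    have hF1 : F ζ₁ = f ⟨ζ₁, hζ₁.1⟩ := by simp [F, hζ₁.1]
    have hF2 : F ζ₂ = f ⟨ζ₂, hζ₂.1⟩ := by simp [F, hζ₂.1]
    rw [hF1, hF2] at hF
    exact congrArg Subtype.val (hinj hF)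

/-- **Hall: the rigid (MM) gives the two-sided permutation on every `l`-class.** -/
theorem exists_twoSided_of_twoHullMasterRigid {l h : V} (hm : TwoHullMasterRigid ends l h)
    (𝓦l : Set (Set V × Set V)) (h𝓦l : IsPairUpSet 𝓦l) :
    ∃ f : {ζ // ζ ∈ lClass ends l h 𝓦l} → Config E, Function.Injective f ∧
      ∀ x, f x ∈ lClass ends l h 𝓦l ∧ TwoSided ends x.1 (f x) h := by
  let t : {ζ // ζ ∈ lClass ends l h 𝓦l} → Finset (Config E) := fun x =>
    (lClass ends l h 𝓦l).filter fun η => TwoSided ends x.1 η h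
  have hall : ∀ s : Finset {ζ // ζ ∈ lClass ends l h 𝓦l}, s.card ≤ (s.biUnion t).card := by
    intro s
    -- the up-set of pairs generated by the rigid pairs of `h` over `s`
    let 𝓦h : Set (Set E × Set E) :=
      {p | ∃ x ∈ s, redEdges ends x.1 h ⊆ p.1 ∧ p.2 ⊆ blueEdges ends x.1 h}
    have h𝓦h : IsPairUpSetE 𝓦h := by
      rintro A A' B B' hA hB ⟨x, hx, hxA, hxB⟩
      exact ⟨x, hx, hxA.trans hA, hB.trans hxB⟩
    have e1 : s.biUnion t = twoHullClassE ends l h 𝓦l (mirror 𝓦h) := by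
      ext η
      rw [twoHullClassE_eq_filter]
      simp only [Finset.mem_biUnion, Finset.mem_filter, t, 𝓦h, mem_mirror, edgePair, TwoSided,
        Set.mem_setOf_eq]
      constructor
      · rintro ⟨x, hx, hη, hred, hblue⟩
        exact ⟨hη, x, hx, hred, hblue⟩
      · rintro ⟨hη, x, hx, hred, hblue⟩
        exact ⟨x, hx, hη, hred, hblue⟩
    have e2 : s.card ≤ (twoHullClassE ends l h 𝓦l 𝓦h).card := by
      rw [twoHullClassE_eq_filter]
      refine Finset.card_le_card_of_injOn (fun x => x.1) ?_ ?_
      · intro x hx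
        rw [Finset.mem_coe] at hx
        simp only [Finset.mem_coe, Finset.mem_filter, 𝓦h, edgePair, Set.mem_setOf_eq]
        exact ⟨x.2, x, hx, le_rfl, le_rfl⟩
      · intro x _ y _ hxy
        exact Subtype.ext hxy
    rw [e1]
    exact e2.trans (hm 𝓦l 𝓦h h𝓦l h𝓦h)
  obtain ⟨f, hf, hft⟩ := (Finset.all_card_le_biUnion_card_iff_exists_injective t).1 hall
  refine ⟨f, hf, fun x => ?_⟩
  have hx := hft x
  simp only [t, Finset.mem_filter] at hx
  exact hx

/-- **The rigid (MM) is the two-sided permutation on every `l`-class.** -/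
theorem twoHullMasterRigid_iff_twoSided {l h : V} :
    TwoHullMasterRigid ends l h ↔
      ∀ 𝓦l : Set (Set V × Set V), IsPairUpSet 𝓦l →
        ∃ f : {ζ // ζ ∈ lClass ends l h 𝓦l} → Config E, Function.Injective f ∧
          ∀ x, f x ∈ lClass ends l h 𝓦l ∧ TwoSided ends x.1 (f x) h :=
  ⟨fun hm 𝓦l h𝓦l => exists_twoSided_of_twoHullMasterRigid hm 𝓦l h𝓦l, twoHullMasterRigid_of_twoSided⟩

end LocRows

end Summit.Ventures.PercRepro2
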